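import Mathlib.Topology.Baire.Lemmas
import Mathlib.Topology.Baire.LocallyCompactRegular
import Mathlib.Topology.Algebra.Group.Basic
import Mathlib.Topology.LocallyConstant.Basic
import HarnessLib

/-!
# Baire uniformisation of pointwise-bounded displacement families on a compact group

PROOF-ONLY generic tool file (pure Mathlib; no definition; nothing specific to semi-graphs or
anabelioids).  Cell abc-iut, layer L3, sub-row **G2·E1b-B2** of GAP row G-t6g3-2 ([SemiAnbd]
Thm. 3.7 (iii) / Cor. 3.9 beyond finite `𝒢`; abc-iut-L3-lead ruling α38 (1), 2026-08-26): the
"Baire uniformisation" input of abc-iut-L3-t6's `exists_fixedSystem_of_pointwise_bdd`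
(G2·E1b = (B1) orbit lemma + (B2) this file).  Seat abc-iut-w6-d066.

THE STATEMENT.  Let `K` be a topological group which is compact and Baire (e.g. compact
Hausdorff), and let `d j : K → ℕ` (`j ∈ ι`, ANY index type) be a family of "displacement functions"
such that, for every `j`,
* the sublevel sets `{g | d j g ≤ N}` are closed (e.g. `d j` is locally constant, or merely upper
  semicontinuous for the order topology of `ℕ`),
* `d j` is SUBADDITIVE, `d j (g * h) ≤ d j g + d j h`, and
* `d j` is SYMMETRIC up to inequality, `d j g⁻¹ ≤ d j g`.
If the family is POINTWISE bounded (`∀ g, ∃ N, ∀ j, d j g ≤ N`) then it is UNIFORMLY bounded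
(`∃ N, ∀ g j, d j g ≤ N`).  (`d j 1 = 0` is not needed.)

THE PROOF (classical Baire-category argument, as for the uniform boundedness principle).  The sets
`F_N := {g | ∀ j, d j g ≤ N}` are closed and cover `K`; by Baire some `F_N` contains a non-empty open
set `V ∋ g₀`.  For `w` in the open neighbourhood `W := g₀⁻¹ V` of `1` and every `j`,
`d j w ≤ d j g₀⁻¹ + d j (g₀ w) ≤ 2N`.  By compactness finitely many left translates `c W` cover `K`;
if `M` bounds the family at the finitely many centres `c`, then `d j g ≤ d j c + d j (c⁻¹ g) ≤ M + 2N`.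

THE INTENDED INSTANCE (abc-iut-L3-t6, STATUS 2026-08-26T06:57:10Z): `K = ↥C` a compact subgroup of the
tempered fundamental group acting on the inverse system of trees `𝒢_{∞,j}`, `x` a compatible system of
vertices, `d j c := dist_j (x j) (c • x j)` the subdivision distance at level `j` — locally constant
(open stabilisers), subadditive and symmetric because `c` acts by isometries; pointwise boundedness over
`j` for each `c ∈ C` is then upgraded to a uniform displacement bound on `C`, which (B1) converts into a
compatible `C`-fixed vertex system.  For that consumer the SUBGROUP forms
`exists_uniform_displacement_bound_on_subgroup` / `…_on_subgroup'` (compact subgroup `C` of a Hausdorff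
topological group, displacements defined on the ambient group) are provided next to the group forms.

Deliberately NOT here: anything about trees, semi-graphs, tempered groups or the orbit lemma (B1).
Mathematically this is the classical Baire-category / translate-and-cover argument (as in the proof of
the Banach–Steinhaus theorem); it is cited to the proof of [SemiAnbd] Thm. 3.7 (iii) p. 41 (author's
*Comments* (2020) (6): the compact subgroup acts on the trees with bounded displacement), of which it is
the uniform-boundedness step. [cite: MochizukiSemiAnbd2006, Thm. 3.7(iii) p.41]
-/

namespace Literature.AnabelianGeometry.SemiGraphs

open Set

universe u v

section Group

variable {K : Type u} [Group K] [TopologicalSpace K] [IsTopologicalGroup K]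
variable {ι : Type v} (d : ι → K → ℕ)

/-- **Baire uniformisation, closed-sublevel form.**  On a compact Baire topological group, a family of
subadditive (`d j (g*h) ≤ d j g + d j h`), inversion-symmetric (`d j g⁻¹ ≤ d j g`) functions `K → ℕ`
with closed sublevel sets which is pointwise bounded (`∀ g, ∃ N, ∀ j, d j g ≤ N`) is uniformly bounded.
Proof: Baire on the closed cover by `F_N = {g | ∀ j, d j g ≤ N}`, translate the interior point to `1`,
cover `K` by finitely many translates. (Classical Baire-category step of the proof of
[SemiAnbd] Thm. 3.7 (iii), author's Comments (2020) (6): the compact subgroup acts on the trees with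
bounded displacement.) [cite: MochizukiSemiAnbd2006, Thm. 3.7(iii) p.41] -/
theorem exists_uniform_displacement_bound_of_isClosed [CompactSpace K] [BaireSpace K]
    (hclosed : ∀ j N, IsClosed {g : K | d j g ≤ N})
    (hmul : ∀ j g h, d j (g * h) ≤ d j g + d j h)
    (hinv : ∀ j g, d j g⁻¹ ≤ d j g)
    (hpt : ∀ g, ∃ N, ∀ j, d j g ≤ N) :
    ∃ N, ∀ g j, d j g ≤ N := by
  classical
  haveI : Nonempty K := ⟨1⟩
  -- the closed cover by the joint sublevel sets
  have hF : ∀ N : ℕ, IsClosed {g : K | ∀ j, d j g ≤ N} := fun N => by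
    have hEq : {g : K | ∀ j, d j g ≤ N} = ⋂ j, {g : K | d j g ≤ N} := by
      ext g
      simp only [mem_setOf_eq, mem_iInter]
    rw [hEq]
    exact isClosed_iInter fun j => hclosed j N
  have hcover : ⋃ N : ℕ, {g : K | ∀ j, d j g ≤ N} = univ := by
    refine eq_univ_of_forall fun g => ?_
    obtain ⟨N, hN⟩ := hpt g
    exact mem_iUnion.2 ⟨N, hN⟩
  -- Baire: one of them has an interior point `g₀`
  obtain ⟨N₀, g₀, hg₀⟩ := nonempty_interior_of_iUnion_of_closed hF hcover
  have hVsub : interior {g : K | ∀ j, d j g ≤ N₀} ⊆ {g : K | ∀ j, d j g ≤ N₀} := interior_subset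
  have hVopen : IsOpen (interior {g : K | ∀ j, d j g ≤ N₀}) := isOpen_interior
  -- on the neighbourhood `g₀⁻¹ V` of `1` every `d j` is bounded by `2 N₀`
  have hWbd : ∀ w : K, g₀ * w ∈ interior {g : K | ∀ j, d j g ≤ N₀} → ∀ j, d j w ≤ N₀ + N₀ := by
    intro w hw j
    have h1 : d j (g₀ * w) ≤ N₀ := hVsub hw j
    have h2 : d j g₀ ≤ N₀ := hVsub hg₀ j
    calc d j w = d j (g₀⁻¹ * (g₀ * w)) := by rw [inv_mul_cancel_left]
      _ ≤ d j g₀⁻¹ + d j (g₀ * w) := hmul j _ _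
      _ ≤ d j g₀ + d j (g₀ * w) := Nat.add_le_add_right (hinv j g₀) _
      _ ≤ N₀ + N₀ := Nat.add_le_add h2 h1
  -- compactness: finitely many translates `c • (g₀⁻¹ V)` cover `K`
  obtain ⟨t, ht⟩ := isCompact_univ.elim_finite_subcover
      (fun c : K => (fun h : K => g₀ * (c⁻¹ * h)) ⁻¹' interior {g : K | ∀ j, d j g ≤ N₀})
      (fun c => hVopen.preimage ((continuous_const_mul g₀).comp (continuous_const_mul c⁻¹)))
      (fun h _ => mem_iUnion.2 ⟨h, by simpa only [mem_preimage, inv_mul_cancel, mul_one] using hg₀⟩)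
  -- a common bound at the finitely many centres
  choose Nc hNc using hpt
  refine ⟨t.sup Nc + (N₀ + N₀), fun g j => ?_⟩
  obtain ⟨c, hct, hc⟩ : ∃ c ∈ t, g₀ * (c⁻¹ * g) ∈ interior {g : K | ∀ j, d j g ≤ N₀} := by
    have hg := ht (mem_univ g)
    simp only [mem_iUnion, mem_preimage, exists_prop] at hg
    exact hg
  have hw : d j (c⁻¹ * g) ≤ N₀ + N₀ := hWbd (c⁻¹ * g) hc j
  calc d j g = d j (c * (c⁻¹ * g)) := by rw [mul_inv_cancel_left]
    _ ≤ d j c + d j (c⁻¹ * g) := hmul j _ _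
    _ ≤ Nc c + (N₀ + N₀) := Nat.add_le_add (hNc c j) hw
    _ ≤ t.sup Nc + (N₀ + N₀) := Nat.add_le_add_right (Finset.le_sup (f := Nc) hct) _

/-- **Baire uniformisation, locally-constant form** (the shape of ruling α38 (1)).  On a compact Baire
topological group, a family of LOCALLY CONSTANT, subadditive, inversion-symmetric functions `K → ℕ`
which is pointwise bounded is uniformly bounded. (Classical Baire-category step of the proof of
[SemiAnbd] Thm. 3.7 (iii), author's Comments (2020) (6): the compact subgroup acts on the trees with
bounded displacement.) [cite: MochizukiSemiAnbd2006, Thm. 3.7(iii) p.41] -/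
theorem exists_uniform_displacement_bound [CompactSpace K] [BaireSpace K]
    (hlc : ∀ j, IsLocallyConstant (d j))
    (hmul : ∀ j g h, d j (g * h) ≤ d j g + d j h)
    (hinv : ∀ j g, d j g⁻¹ ≤ d j g)
    (hpt : ∀ g, ∃ N, ∀ j, d j g ≤ N) :
    ∃ N, ∀ g j, d j g ≤ N :=
  exists_uniform_displacement_bound_of_isClosed d
    (fun j N => by
      -- `{g | d j g ≤ N} = (d j) ⁻¹' Iic N`, whose complement is an open preimage
      have h : IsOpen ((d j) ⁻¹' (Set.Iic N)ᶜ) := hlc j _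
      exact isOpen_compl_iff.mp h)
    hmul hinv hpt

/-- **Baire uniformisation on a compact Hausdorff group** (Baire is automatic: a compact Hausdorff
space is locally compact, hence Baire).  Locally constant, subadditive, inversion-symmetric,
pointwise-bounded families `K → ℕ` are uniformly bounded. (Classical Baire-category step of the proof of
[SemiAnbd] Thm. 3.7 (iii), author's Comments (2020) (6): the compact subgroup acts on the trees with
bounded displacement.) [cite: MochizukiSemiAnbd2006, Thm. 3.7(iii) p.41] -/
theorem exists_uniform_displacement_bound_of_t2 [CompactSpace K] [T2Space K]
    (hlc : ∀ j, IsLocallyConstant (d j))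
    (hmul : ∀ j g h, d j (g * h) ≤ d j g + d j h)
    (hinv : ∀ j g, d j g⁻¹ ≤ d j g)
    (hpt : ∀ g, ∃ N, ∀ j, d j g ≤ N) :
    ∃ N, ∀ g j, d j g ≤ N :=
  exists_uniform_displacement_bound d hlc hmul hinv hpt

/-- Closed-sublevel form on a compact Hausdorff group (upper-semicontinuous displacements, e.g. the
integer part of a continuous real displacement). (Classical Baire-category step of the proof of
[SemiAnbd] Thm. 3.7 (iii), author's Comments (2020) (6): the compact subgroup acts on the trees with
bounded displacement.) [cite: MochizukiSemiAnbd2006, Thm. 3.7(iii) p.41] -/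
theorem exists_uniform_displacement_bound_of_t2_of_isClosed [CompactSpace K] [T2Space K]
    (hclosed : ∀ j N, IsClosed {g : K | d j g ≤ N})
    (hmul : ∀ j g h, d j (g * h) ≤ d j g + d j h)
    (hinv : ∀ j g, d j g⁻¹ ≤ d j g)
    (hpt : ∀ g, ∃ N, ∀ j, d j g ≤ N) :
    ∃ N, ∀ g j, d j g ≤ N :=
  exists_uniform_displacement_bound_of_isClosed d hclosed hmul hinv hpt

end Group

/-! ### Compact subgroups of a Hausdorff topological group

The form consumed by abc-iut-L3-t6's (B1)/(B2) assembly: the displacements are functions on the AMBIENT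
group `G` (the tempered fundamental group acting on every level), the subgroup `C ≤ G` is compact, and
only the restrictions to `C` are required to be locally constant / subadditive / symmetric / pointwise
bounded. -/

section Subgroup

variable {G : Type u} [Group G] [TopologicalSpace G] [IsTopologicalGroup G] [T2Space G]
variable (C : _root_.Subgroup G) {ι : Type v} (d : ι → G → ℕ)

/-- **Baire uniformisation on a compact subgroup** (restricted hypotheses).  `C` a compact subgroup of
a Hausdorff topological group `G`, `d j : G → ℕ` a family whose RESTRICTIONS to `C` are locally
constant, subadditive and inversion-symmetric on `C`, and pointwise bounded on `C`; then the family is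
uniformly bounded on `C`: `∃ N, ∀ g ∈ C, ∀ j, d j g ≤ N`. (Classical Baire-category step of the proof of
[SemiAnbd] Thm. 3.7 (iii), author's Comments (2020) (6): the compact subgroup acts on the trees with
bounded displacement.) [cite: MochizukiSemiAnbd2006, Thm. 3.7(iii) p.41] -/
theorem exists_uniform_displacement_bound_on_subgroup' (hC : IsCompact (C : Set G))
    (hlc : ∀ j, IsLocallyConstant fun c : C => d j (c : G))
    (hmul : ∀ j, ∀ g ∈ C, ∀ h ∈ C, d j (g * h) ≤ d j g + d j h)
    (hinv : ∀ j, ∀ g ∈ C, d j g⁻¹ ≤ d j g)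
    (hpt : ∀ g ∈ C, ∃ N, ∀ j, d j g ≤ N) :
    ∃ N, ∀ g ∈ C, ∀ j, d j g ≤ N := by
  haveI : CompactSpace C := isCompact_iff_compactSpace.mp hC
  obtain ⟨N, hN⟩ := exists_uniform_displacement_bound_of_t2 (K := C) (fun j (c : C) => d j (c : G))
    hlc (fun j g h => hmul j g g.2 h h.2) (fun j g => hinv j g g.2) (fun g => hpt g g.2)
  exact ⟨N, fun g hg j => hN ⟨g, hg⟩ j⟩

/-- **Baire uniformisation on a compact subgroup** (global hypotheses; the simplest form to apply when
the displacements are locally constant on all of `G`, e.g. `g ↦ dist (x, g • x)` for a continuous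
action with open stabilisers by isometries).  `C` compact in a Hausdorff topological group `G`,
`d j : G → ℕ` locally constant, subadditive and inversion-symmetric, pointwise bounded on `C`
⟹ uniformly bounded on `C`. (Classical Baire-category step of the proof of
[SemiAnbd] Thm. 3.7 (iii), author's Comments (2020) (6): the compact subgroup acts on the trees with
bounded displacement.) [cite: MochizukiSemiAnbd2006, Thm. 3.7(iii) p.41] -/
theorem exists_uniform_displacement_bound_on_subgroup (hC : IsCompact (C : Set G))
    (hlc : ∀ j, IsLocallyConstant (d j))
    (hmul : ∀ j g h, d j (g * h) ≤ d j g + d j h)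
    (hinv : ∀ j g, d j g⁻¹ ≤ d j g)
    (hpt : ∀ g ∈ C, ∃ N, ∀ j, d j g ≤ N) :
    ∃ N, ∀ g ∈ C, ∀ j, d j g ≤ N :=
  exists_uniform_displacement_bound_on_subgroup' C d hC
    (fun j => (hlc j).comp_continuous continuous_subtype_val)
    (fun j g _ h _ => hmul j g h) (fun j g _ => hinv j g) hpt

/-- Closed-sublevel variant on a compact subgroup: it suffices that the sublevel sets of the
restrictions `{c : C | d j c ≤ N}` are closed in `C`. (Classical Baire-category step of the proof of
[SemiAnbd] Thm. 3.7 (iii), author's Comments (2020) (6): the compact subgroup acts on the trees with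
bounded displacement.) [cite: MochizukiSemiAnbd2006, Thm. 3.7(iii) p.41] -/
theorem exists_uniform_displacement_bound_on_subgroup_of_isClosed (hC : IsCompact (C : Set G))
    (hclosed : ∀ j N, IsClosed {c : C | d j (c : G) ≤ N})
    (hmul : ∀ j, ∀ g ∈ C, ∀ h ∈ C, d j (g * h) ≤ d j g + d j h)
    (hinv : ∀ j, ∀ g ∈ C, d j g⁻¹ ≤ d j g)
    (hpt : ∀ g ∈ C, ∃ N, ∀ j, d j g ≤ N) :
    ∃ N, ∀ g ∈ C, ∀ j, d j g ≤ N := by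
  haveI : CompactSpace C := isCompact_iff_compactSpace.mp hC
  obtain ⟨N, hN⟩ := exists_uniform_displacement_bound_of_t2_of_isClosed (K := C)
    (fun j (c : C) => d j (c : G)) hclosed (fun j g h => hmul j g g.2 h h.2)
    (fun j g => hinv j g g.2) (fun g => hpt g g.2)
  exact ⟨N, fun g hg j => hN ⟨g, hg⟩ j⟩

end Subgroup

end Literature.AnabelianGeometry.SemiGraphs
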